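import Literature.Barriers.NavierStokesRegularity.CriticalDataSmoothNonuniquenessConstruction
import Literature.Barriers.NavierStokesRegularity.CriticalDataSmoothNonuniquenessGlobal
import HarnessLib

/-!
# Coiculescu–Palasek 2025, Thm. 1.2: the barrier fact from the principal parts (explicit
  hypothesis), the perturbation theorem (named fact) and the global extension (discharged)
  — FIRST assembly, DEPRECATED (its named-fact hypothesis is refuted)

STATUS (named-fact verdict clean-up, 2026-08-16). The named fact this assembly consumes,
`CoiculescuPalasek2025_perturbation` (`…Construction`; Props. 4.2–4.3 abstracted to every
approximate solution and EVERY Hölder exponent `κ ∈ (0, 1/2 - 4α)`, with the `Ċ^{1,κ}` slot of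
`‖w‖_X ≤ ε₁`), is REFUTED AS STATED — `not_CoiculescuPalasek2025_perturbation`
(`…PerturbationRefuted`; the printed proof of Prop. 4.2 supports the `Ċ^{1,κ}` slot only for
`κ ≤ α`) — and is now a `@[deprecated]` record retired from the named-fact debt. The one theorem
of this file is therefore VACUOUS and is deprecated with it (kept verbatim, not deleted: it is the
record of the first assembly and the reason the record in `…Construction` is kept). The sound
assemblies, in files that do not import this one: `CriticalDataSmoothNonuniqueness_of_principalParts`
(`…PerturbationReduced`: the reduced perturbation step is PROVED there,
`CoiculescuPalasek2025_perturbation_reduced`, so the barrier follows from the principal parts `hA`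
ALONE), `CriticalDataSmoothNonuniqueness_of_principalParts_of_perturbationThreshold/…Le`
(`…ThresholdAssembly`) and `CriticalDataSmoothNonuniqueness_of_principalParts_of_perturbation'`
(`…CorrectedAssembly`; corrected statement with `κ ≤ α` as an explicit hypothesis). The text
below describes the file as designed (2026-08-15).

Assembly file of the barrier entry
`Literature/Barriers/NavierStokesRegularity/CriticalDataSmoothNonuniqueness` (D-0021; M. P.
Coiculescu, S. Palasek, *Non-uniqueness of smooth solutions of the Navier–Stokes equations from
critical data*, Invent. Math. 244 (2025), 165–219, arXiv:2503.14699, Thm. 1.2 with Rmk. 1.3),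
joining its two sibling proof files, which do not import each other:

* `CriticalDataSmoothNonuniquenessConstruction` proves the FINITE-TIME CONSTRUCTION (§§3–4 and
  §5 up to its last paragraph; the explicit hypothesis `h₁` of
  `CriticalDataSmoothNonuniqueness_of_parts`) from the paper's PRINCIPAL PARTS WITH THEIR
  RESIDUALS (Def. 3.10, Prop. 3.13, Prop. 4.1 and the `v⁽ⁱ⁾`-only estimates of §5) — an explicit
  hypothesis, the remaining proof obligation of the barrier (it was briefly the named fact
  `CoiculescuPalasek2025_principalParts`; merged back on split review, 2026-08-15, D-0026: fact
  decompositions do not recurse and a child of a split is a distinct, M-sized published result,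
  which the whole of §3 with Prop. 4.1 is not) — and the named fact
  `CoiculescuPalasek2025_perturbation` (Props. 4.2–4.3): `CoiculescuPalasek2025_construction_of_parts`;
* `CriticalDataSmoothNonuniquenessGlobal` DISCHARGES the small-data global extension (§5, last
  paragraph): `CoiculescuPalasek2025_globalExtension_holds`.

Proved here: `CriticalDataSmoothNonuniqueness_of_principalParts_of_perturbation` — the barrier
fact follows from the principal parts (explicit hypothesis `hA`, literally the hypothesis `hA` of
`CoiculescuPalasek2025_construction_of_parts`, whose docstring carries the clause-by-clause
citations) and the perturbation theorem. This records in one theorem what remains between the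
tree and the barrier fact: `CriticalDataSmoothNonuniqueness ⟸ (principal parts) ∧ perturbation ∧
globalExtension`, the last conjunct proved, the first the paper's §3 with Prop. 4.1 (a theory:
SIZE XL), the second a named fact. Nothing else is in this file.

## References

* M. P. Coiculescu, S. Palasek, Invent. Math. 244 (2025), 165–219,
  doi:10.1007/s00222-025-01396-z, arXiv:2503.14699: Def. 3.10, Prop. 3.13, Prop. 4.1, §5 (proof
  of Thm. 1.2). [`CoiculescuPalasek2025`]
-/

noncomputable section

open Set Filter
open _root_.Topology
open scoped InnerProductSpace RealInnerProductSpace NNReal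

namespace Literature.Barriers.NavierStokesRegularity

open Literature.Analysis.FunctionSpaces CoiculescuPalasek2025

-- names the `@[deprecated]` record `CoiculescuPalasek2025_perturbation` and the deprecated first
-- assembly `CoiculescuPalasek2025_construction_of_parts` (`…Construction`) on purpose: this is the
-- record of the first assembly over that record (verdict clean-up 2026-08-16); REMOVE-WHEN this
-- vacuous theorem is deleted (nothing applies it; the sound assembly is
-- `CriticalDataSmoothNonuniqueness_of_principalParts` in `…PerturbationReduced`).
set_option linter.deprecated false in
/-- **DEPRECATED (2026-08-16) — vacuous: hypothesis `hB` is the refuted record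
`CoiculescuPalasek2025_perturbation` (`not_CoiculescuPalasek2025_perturbation`); use
`CriticalDataSmoothNonuniqueness_of_principalParts` (`…PerturbationReduced`, from `hA` alone, the
reduced perturbation step being proved there), or
`CriticalDataSmoothNonuniqueness_of_principalParts_of_perturbationLe/…Threshold` (`…ThresholdAssembly`),
`CriticalDataSmoothNonuniqueness_of_principalParts_of_perturbation'` (`…CorrectedAssembly`).**
*Content (unchanged):*
**The barrier fact from the principal parts and the perturbation theorem.** The principal
parts with their residuals (hypothesis `hA`, stated explicitly: Def. 3.10, Prop. 3.13, Prop. 4.1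
and the `v⁽ⁱ⁾`-only estimates of §5 of Coiculescu–Palasek 2025, transported to
`(0, T_*] × (ℝ/ℤ)³` — for every `α ∈ (0, 1/8)` a Hölder exponent `κ ∈ (0, 1/2 - 4α)` and constants
`K, C` such that for all targets `ε₀, η, δ > 0`, `L` there are two approximate solutions
`(vᵢ, Fᵢ, πᵢ)` in the sense of `CoiculescuPalasek2025.IsApproximateSolution`, distinct with margin
`L` at some `t₀`, with a common datum in the `Ḣ^{-1}`/pairing sense, and of sup norm `≤ δ` at
`T_*`; it is literally the hypothesis `hA` of `CoiculescuPalasek2025_construction_of_parts`, whose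
docstring carries the clause-by-clause citations, and it is the remaining proof obligation of
the barrier, not a named fact — see the module docstring) and the perturbation theorem
(`CoiculescuPalasek2025_perturbation`: Props. 4.2–4.3) imply `CriticalDataSmoothNonuniqueness`
(Thm. 1.2 with Rmk. 1.3 as rendered): the finite-time construction is
`CoiculescuPalasek2025_construction_of_parts`, the small-data global extension is the discharged
fact `CoiculescuPalasek2025_globalExtension_holds`, and the two are assembled by
`CriticalDataSmoothNonuniqueness_of_parts` (§5, last paragraph: "existence of a global-in-time
solution follows").
[cite: CoiculescuPalasek2025, Def. 3.10, Prop. 3.13, Prop. 4.1 and §5 (proof of Thm. 1.2)] -/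
@[deprecated "vacuous since 2026-08-16: its hypothesis hB = CoiculescuPalasek2025_perturbation is refuted (not_CoiculescuPalasek2025_perturbation). Use Literature.Barriers.NavierStokesRegularity.CriticalDataSmoothNonuniqueness_of_principalParts (CriticalDataSmoothNonuniquenessPerturbationReduced.lean: needs the principal parts hA only) or CriticalDataSmoothNonuniqueness_of_principalParts_of_perturbationLe / …Threshold (CriticalDataSmoothNonuniquenessThresholdAssembly.lean), CriticalDataSmoothNonuniqueness_of_principalParts_of_perturbation' (CriticalDataSmoothNonuniquenessCorrectedAssembly.lean)" (since := "2026-08-16")]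
theorem CriticalDataSmoothNonuniqueness_of_principalParts_of_perturbation
    (hA : ∀ α : ℝ, 0 < α → α < 1 / 8 →
      ∃ κ : ℝ≥0, 0 < κ ∧ (κ : ℝ) < 1 / 2 - 4 * α ∧
      ∃ (K : ℕ → ℝ) (C : ℝ),
      ∀ (ε₀ η L δ : ℝ), 0 < ε₀ → 0 < η → 0 < δ →
      ∃ (v₁ v₂ : ℝ → UnitAddTorus (Fin 3) → EuclideanSpace ℝ (Fin 3))
        (F₁ F₂ : ℝ → UnitAddTorus (Fin 3) → (Fin 3 → Fin 3 → ℝ))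
        (π₁ π₂ : ℝ → UnitAddTorus (Fin 3) → ℝ),
        IsApproximateSolution unitTime α κ K C η ε₀ v₁ F₁ π₁ ∧
        IsApproximateSolution unitTime α κ K C η ε₀ v₂ F₂ π₂ ∧
        (∃ t₀ ∈ Ioc (0 : ℝ) unitTime, ∃ x₀ : UnitAddTorus (Fin 3),
          L ≤ t₀ ^ ((1 - α) / 2) * ‖v₁ t₀ x₀ - v₂ t₀ x₀‖) ∧
        Tendsto (fun t =>
            Torus.eHomSobolevSeminorm (-1) (EuclideanSpace.complexify ∘ (v₁ t - v₂ t)))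
          (𝓝[>] 0) (𝓝 0) ∧
        Tendsto (fun st : ℝ × ℝ =>
            Torus.eHomSobolevSeminorm (-1) (EuclideanSpace.complexify ∘ (v₁ st.1 - v₁ st.2)))
          ((𝓝[>] (0 : ℝ)) ×ˢ (𝓝[>] (0 : ℝ))) (𝓝 0) ∧
        Tendsto (fun st : ℝ × ℝ =>
            Torus.eHomSobolevSeminorm (-1) (EuclideanSpace.complexify ∘ (v₂ st.1 - v₂ st.2)))
          ((𝓝[>] (0 : ℝ)) ×ˢ (𝓝[>] (0 : ℝ))) (𝓝 0) ∧
        (∀ φ : UnitAddTorus (Fin 3) → EuclideanSpace ℝ (Fin 3), Torus.IsSmooth φ →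
          Torus.HasZeroMean φ →
          ∃ c : ℝ, Tendsto (fun t => ∫ x, ⟪v₁ t x, φ x⟫) (𝓝[>] 0) (𝓝 c) ∧
            Tendsto (fun t => ∫ x, ⟪v₂ t x, φ x⟫) (𝓝[>] 0) (𝓝 c)) ∧
        (∀ x, ‖v₁ unitTime x‖ ≤ δ ∧ ‖v₂ unitTime x‖ ≤ δ))
    (hB : CoiculescuPalasek2025_perturbation) :
    CriticalDataSmoothNonuniqueness :=
  CriticalDataSmoothNonuniqueness_of_parts (CoiculescuPalasek2025_construction_of_parts hA hB)
    CoiculescuPalasek2025_globalExtension_holds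

end Literature.Barriers.NavierStokesRegularity
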